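import Summits.QuantumFields.YangMills.Theorems.BalabanUVNodesN22GenStepRecursion
import Literature.MathematicalPhysics.QuantumFieldTheory.Dimock2015.AnalyticLipschitz

/-!
# BalabanUVNodes ∕ node N22 = NE9 — THE GENERATOR SCHEMAS FROM ONE ANALYTICITY BINDER: module J53∕J54's first-order schema (G-T1) (older-term part) AND dag-n22-a's
# SECOND-ORDER schema (G-T2-old) on node00-def-W1's one-step map `(t, old) ↦ (G k).E t old φ X` both follow from an ANALYTIC READING of the map into a complex Banach
# space — holomorphic and bounded by `M_b·e^{−κd}` on a ball containing the read admissible older-term families with a margin `ϱ` — by Cauchy at first AND second order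

Cell `pub-ymgap`, HUMAN RULING D-0062 (Track A), R134 seat `pub-ymgap-dag-n22-c` (strategy s1), generation 18, module J57.  THEOREMS ONLY (no `def`, no `sorry`, standard axioms);
`--kind proof --supports stmt-QuantumFields-27366 --as helper` (K3⁸ `SpineGivenEndpointR13SepCoPHV`), COUNT-NEUTRAL.  Imports module J53 `…N22GenStepRecursion` (def-W1's
`HistoryRecursionOfRecord`: `GenTower`, `StepGen.E`, `OlderTerms`; through it `B12Ineq418Flat.norm_secondDiff_le`) and `Dimock2015.AnalyticLipschitz` (`norm_sub_le_of_margin` —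
the kernel of pub-balaban's `T4HistoryLipschitzOuter` §4–§5).  Nothing re-declared; every step is plain application.

WHY (module J54's census, g17 «Untried: holomorphy-in-`old` ⇒ (G-T1) by Cauchy (infinite-dimensional)»).  Modules J53∕J54 (ROAD 2 in generator currency) display THREE one-step-map
schemas on def-W1's generator: (G-T1) (Lipschitz in the last coupling and, through a weighted linear channel `a k j`, in the older-term family), (G-T2-last), and dag-n22-a's
SECOND-ORDER schema (G-T2-old) (linear channel `a` on second differences of the older terms, variance channel `b` on squares of first differences) — cell NEW-ESTIMATE shapes,
NOT PRINTED.  pub-balaban's NE9-P2 leaf (`T4HistoryLipschitzOuter` §4–§5, `outputLipschitz_of_analyticOn_ball`) already derives the FIRST-order older-term modulus from a binder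
«of the TYPE Bałaban prints everywhere — ANALYTICITY + SIZE on a complex domain with a margin» read into ANY complex normed space.  THIS FILE shows that the SAME binder, stated for
def-W1's one-step map, yields (G-T1)'s older-term part AND (G-T2-old) — so ROAD 2's generator-currency bill (J54) carries NO second-order older-term schema beyond the analyticity
binder ROAD 1 ∕ NE9-P2 rests on (module J58 composes it at the record).  THE ANALYTIC READING (displayed hypotheses; per step `k`, a complex normed space `Pot k`, a reading
`ρ k : OlderTerms → Pot k`, a map `A k t φ X : Pot k → ℂ`):
* (AR-fact) `(G k).E t old φ X = A k t φ X (ρ k old)` for `t ∈ ]0, γ]`, admissible `old`, `φ` in the space table — the new term reads the older terms through `ρ k` (locality);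
* (AR-holo) `A k t φ X` is complex differentiable on the open ball `ball 0 R` with `‖A k t φ X‖ ≤ M_b·e^{−κ d_{k+1}(X)}` there ([II] (2.14)–(2.15) p. 15 «we consider it as an analytic
  function of (U, J) … and of the complex parameters σ(Z), τ», read for the older terms AS INDEPENDENT VARIABLES — the cell's reading, NOT printed: GAPS G-ne9p2-5);
* (AR-adm) admissible families are read into `closedBall 0 r₀`, `r₀ + ϱ < R` (the MARGIN `ϱ` — print's «ε₁ sufficiently small», [II] p. 18, under the cell's units);
* (AR-dom₁)∕(AR-dom₂) the reading of first ∕ second differences of ADMISSIBLE families is dominated entrywise by the decay-weighted space-table values with level weights `w k j ≥ 0`,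
  `w k 0 = 0` (sup-norm type: `‖ρ o − ρ o′‖ ≤ B` as soon as every weighted entry `w k j·e^{κ d_j(Y)}·‖(o − o′)_j(Y; φ′)‖ ≤ B`; the same for `ρ o₁ − 2ρ o₂ + ρ o₃`).
RESULTS: §1 Banach devices [folklore, from the tree lemmas]: `norm_sub_le_of_ballMargin` (first order on a ball with a margin: `(4M_b∕ϱ)·‖x − y‖`) and ★ `norm_threePoint_le_of_ballMargin`
— **`‖f x₁ − 2f x₂ + f x₃‖ ≤ (4M_b∕ϱ)·‖x₁ − 2x₂ + x₃‖ + (16M_b∕ϱ²)·‖x₁ − x₃‖²`** for ANY three points of the admissible ball (midpoint split: the symmetric second difference along the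
complex LINE through `x₃, (x₁+x₃)∕2, x₁` by `norm_secondDiff_le`, the first difference `f((x₁+x₃)∕2) − f x₂` by the margin lemma; no derivative linearity, no plane-holomorphy).
§2 ★ `genT1_of_analyticReading` — (AR) + the LAST-coupling schema (G-T1-last) ([I] (1.17)-type) ⟹ **(G-T1) with channel `a k j = (4M_b∕ϱ)·w k j`**; ★ `genT2old_of_analyticReading` — (AR) ⟹
**(G-T2-old) with channels `a k j = (4M_b∕ϱ)·w k j`, `b k j = (64M_b∕ϱ²)·(w k j)²`** (the non-negativity of the majorants at the levels `1, …, k` comes from the non-empty space tables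
on the inhabited domain types of record, `cubeDom`).  With `w k j ≤ c_w·ω₁^{k−j}` these meet J53∕J54's rows at `c = 4M_b c_w∕ϱ`, `c_b = 64M_b c_w²∕ϱ²` (module J58).

HONEST FRAMING (binding).  Count-neutral COMPOSITION of tree lemmas (Cauchy estimates in complex normed spaces) with def-W1's generator BY TYPING; (AR) is a HYPOTHESIS SHAPE on
def-W1's generator (inhabited by every generator ignoring `old`, with `A` constant in `Pot`-direction — A5: content = the composition's shape, conditional); NO estimate of Bałaban's
is proved or asserted; nothing of the record is constructed or claimed to meet (AR); a producer is node N10 ∕ NODE A on def-T's generator of record.  N22 is NOT discharged (typed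
28∕28 · discharged 5∕27 UNCHANGED); K3⁸ OPEN and NOT claimed (no stub of 27366 touched); NE9 is NOT IN PRINT for d = 4; no count claim; one finite 𝕋⁴ programme at fixed ε — R4
closes the CONDITIONAL rung `BalabanLadder.UV` only; NOTHING about the continuum limit, ℝ⁴, infinite volume, OS axioms, a mass gap or the Clay problem is proved or claimed.
References (TYPES only): [I] = Bałaban, CMP 109 (1987) (1.17)–(1.18) p. 263, (2.12)–(2.13) p. 268, §5 p. 298; [II] = CMP 116 (1988) (1.41) p. 11, (2.13)–(2.15) pp. 14–15, p. 18;
Dimock, J. Stat. Phys. 2013∕2015 (the Banach-ball analyticity framing, tree module `Dimock2015.AnalyticLipschitz`); Chae, *Holomorphy and Calculus in Normed Spaces* (1985) ch. 2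
(Cauchy inequalities — folklore).
-/

noncomputable section

open Set Metric
open scoped BigOperators

namespace YMDAG.N22.TermRecursion

open Literature.MathematicalPhysics.QuantumFieldTheory.Balaban1983to89
open Literature.MathematicalPhysics.QuantumFieldTheory.Balaban1983to89.T4OutputRate (Window)
open Literature.MathematicalPhysics.QuantumFieldTheory.Balaban1983to89.Node00.Sect2 (domSys CPair cubeDom)
open Literature.MathematicalPhysics.QuantumFieldTheory.Balaban1983to89.Node00.W1
open Literature.MathematicalPhysics.QuantumFieldTheory.Dimock2015 (norm_sub_le_of_margin)
open Literature.MathematicalPhysics.QuantumFieldTheory.Balaban1983to89.B12Ineq418Flat (norm_secondDiff_le)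

/-! ## §1 Banach devices: Cauchy at first and second order on a ball with a margin -/
section Banach

variable {Pot : Type*} [NormedAddCommGroup Pot] [NormedSpace ℂ Pot]

/-- FIRST ORDER ON A BALL WITH A MARGIN: `f` holomorphic with `‖f‖ ≤ M_b` on the open ball `ball 0 R` of a complex normed space, `r₀ + ϱ < R`, `ϱ > 0` ⟹ for
`‖x‖, ‖y‖ ≤ r₀`: `‖f x − f y‖ ≤ (4M_b∕ϱ)·‖x − y‖` — `Dimock2015.norm_sub_le_of_margin` with the comparison set `closedBall 0 r₀`. [folklore] -/
theorem norm_sub_le_of_ballMargin {f : Pot → ℂ} {R r₀ ϱ Mb : ℝ} (hϱ : 0 < ϱ) (hR : r₀ + ϱ < R)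
    (hf : DifferentiableOn ℂ f (ball 0 R)) (hM : ∀ p ∈ ball (0 : Pot) R, ‖f p‖ ≤ Mb) {x y : Pot} (hx : ‖x‖ ≤ r₀) (hy : ‖y‖ ≤ r₀) :
    ‖f x - f y‖ ≤ 4 * Mb / ϱ * ‖x - y‖ := by
  refine norm_sub_le_of_margin (S := closedBall 0 r₀) hϱ hf hM (fun q hq z hz => ?_) (mem_closedBall_zero_iff.mpr hx) (mem_closedBall_zero_iff.mpr hy)
  rw [mem_closedBall_zero_iff] at hq
  rw [mem_closedBall, dist_eq_norm] at hz
  rw [mem_ball_zero_iff]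
  calc ‖z‖ = ‖(z - q) + q‖ := by rw [sub_add_cancel]
    _ ≤ ‖z - q‖ + ‖q‖ := norm_add_le _ _
    _ < R := by linarith

/-- ★ **THREE-POINT SECOND ORDER ON A BALL WITH A MARGIN.**  `f` holomorphic with `‖f‖ ≤ M_b` on `ball 0 R`, `r₀ + ϱ < R`, `ϱ > 0`; then for ANY three points of norm `≤ r₀`:
**`‖f x₁ − 2 f x₂ + f x₃‖ ≤ (4M_b∕ϱ)·‖x₁ − 2x₂ + x₃‖ + (16M_b∕ϱ²)·‖x₁ − x₃‖²`** — the MIDPOINT SPLIT `f x₁ − 2f x₂ + f x₃ = (f x₁ − 2f m + f x₃) + 2(f m − f x₂)`, `m = (x₁ + x₃)∕2`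
(norm `≤ r₀` by convexity): the symmetric second difference ALONG THE LINE through `x₃, m, x₁` by `B12Ineq418Flat.norm_secondDiff_le` (margin `ϱ∕4` when `‖x₁ − x₃‖ ≤ ϱ∕2`; the
trivial bound `4M_b ≤ 16M_b‖x₁ − x₃‖²∕ϱ²` otherwise), the first difference `f m − f x₂` by `norm_sub_le_of_ballMargin` (`‖m − x₂‖ = ‖x₁ − 2x₂ + x₃‖∕2`).  No linearity of a
derivative and no plane-holomorphy is used — complex LINES suffice. [folklore] -/
theorem norm_threePoint_le_of_ballMargin {f : Pot → ℂ} {R r₀ ϱ Mb : ℝ} (hϱ : 0 < ϱ) (hR : r₀ + ϱ < R)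
    (hf : DifferentiableOn ℂ f (ball 0 R)) (hM : ∀ p ∈ ball (0 : Pot) R, ‖f p‖ ≤ Mb) {x₁ x₂ x₃ : Pot} (h₁ : ‖x₁‖ ≤ r₀) (h₂ : ‖x₂‖ ≤ r₀) (h₃ : ‖x₃‖ ≤ r₀) :
    ‖f x₁ - 2 * f x₂ + f x₃‖ ≤ 4 * Mb / ϱ * ‖x₁ - (2 : ℂ) • x₂ + x₃‖ + 16 * Mb / ϱ ^ 2 * ‖x₁ - x₃‖ ^ 2 := by
  have hr₀ : 0 ≤ r₀ := (norm_nonneg _).trans h₁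
  have hR0 : 0 < R := by linarith
  have hMb : 0 ≤ Mb := (norm_nonneg _).trans (hM 0 (mem_ball_self hR0))
  have hball : ∀ p : Pot, ‖p‖ ≤ r₀ → p ∈ ball (0 : Pot) R := fun p hp => mem_ball_zero_iff.mpr (by linarith)
  -- the midpoint `m` and the half-chord `V` (opaque names)
  obtain ⟨m, hm⟩ : ∃ m : Pot, m = (2⁻¹ : ℂ) • (x₁ + x₃) := ⟨_, rfl⟩
  obtain ⟨V, hV⟩ : ∃ V : Pot, V = (2⁻¹ : ℂ) • (x₁ - x₃) := ⟨_, rfl⟩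
  have h2 : ‖(2⁻¹ : ℂ)‖ = 2⁻¹ := by rw [norm_inv, Complex.norm_ofNat]
  have hVn : ‖V‖ = ‖x₁ - x₃‖ / 2 := by rw [hV, norm_smul, h2]; ring
  have hmn : ‖m‖ ≤ r₀ := by
    rw [hm, norm_smul, h2]
    have := norm_add_le x₁ x₃
    linarith
  have hmV : x₃ + V = m := by rw [hV, hm]; module
  have hx₁ : x₃ + V + V = x₁ := by rw [hV]; module
  have hmx : m - x₂ = (2⁻¹ : ℂ) • (x₁ - (2 : ℂ) • x₂ + x₃) := by rw [hm]; module
  -- the split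
  have esplit : f x₁ - 2 * f x₂ + f x₃ = (f (x₃ + V + V) - f (x₃ + V) - f (x₃ + V) + f x₃) + 2 * (f m - f x₂) := by
    rw [hx₁, hmV]; ring
  rw [esplit]
  refine (norm_add_le _ _).trans ?_
  rw [add_comm (4 * Mb / ϱ * _)]
  refine add_le_add ?_ ?_
  · -- the symmetric second difference along the line through `x₃, m, x₁`
    by_cases hsmall : ‖x₁ - x₃‖ ≤ ϱ / 2
    · have hVϱ : ‖V‖ ≤ ϱ / 4 := by rw [hVn]; linarith
      have hmem : ∀ s t : ℂ, ‖s‖ * ‖V‖ < ‖V‖ + ϱ / 4 → ‖t‖ * ‖V‖ < ‖V‖ + ϱ / 4 → x₃ + s • V + t • V ∈ ball (0 : Pot) R := by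
        intro s t hs ht
        rw [mem_ball_zero_iff]
        have e1 : ‖s • V‖ = ‖s‖ * ‖V‖ := norm_smul s V
        have e2 : ‖t • V‖ = ‖t‖ * ‖V‖ := norm_smul t V
        calc ‖x₃ + s • V + t • V‖ ≤ ‖x₃ + s • V‖ + ‖t • V‖ := norm_add_le _ _
          _ ≤ ‖x₃‖ + ‖s • V‖ + ‖t • V‖ := by gcongr; exact norm_add_le _ _
          _ < r₀ + (‖V‖ + ϱ / 4) + (‖V‖ + ϱ / 4) := by rw [e1, e2]; linarith
          _ ≤ r₀ + ϱ := by linarith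
          _ < R := hR
      have h := norm_secondDiff_le isOpen_ball hf hMb (by positivity : (0 : ℝ) < ϱ / 4) x₃ V V hmem hM
      refine h.trans ?_
      have hϱ2 : 0 < ϱ ^ 2 := by positivity
      have e : Mb * ‖V‖ * ‖V‖ / (ϱ / 4) ^ 2 = 4 * (Mb / ϱ ^ 2 * ‖x₁ - x₃‖ ^ 2) := by rw [hVn]; field_simp; ring
      have e' : 16 * Mb / ϱ ^ 2 * ‖x₁ - x₃‖ ^ 2 = 16 * (Mb / ϱ ^ 2 * ‖x₁ - x₃‖ ^ 2) := by ring
      have h0 : 0 ≤ Mb / ϱ ^ 2 * ‖x₁ - x₃‖ ^ 2 := by positivity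
      rw [e, e']
      linarith
    · -- far apart (`ϱ∕2 < ‖x₁ − x₃‖`): the trivial bound `4M_b ≤ 16M_b‖x₁ − x₃‖²∕ϱ²`
      have hlt : ϱ / 2 < ‖x₁ - x₃‖ := lt_of_not_ge hsmall
      have hb1 := hM _ (hball _ h₁)
      have hb3 := hM _ (hball _ h₃)
      have hbm := hM _ (hball _ hmn)
      rw [hx₁, hmV]
      have h4 : ‖f x₁ - f m - f m + f x₃‖ ≤ 4 * Mb := by
        calc ‖f x₁ - f m - f m + f x₃‖ ≤ ‖f x₁ - f m - f m‖ + ‖f x₃‖ := norm_add_le _ _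
          _ ≤ ‖f x₁ - f m‖ + ‖f m‖ + ‖f x₃‖ := by gcongr; exact norm_sub_le _ _
          _ ≤ ‖f x₁‖ + ‖f m‖ + ‖f m‖ + ‖f x₃‖ := by gcongr; exact norm_sub_le _ _
          _ ≤ Mb + Mb + Mb + Mb := by gcongr
          _ = 4 * Mb := by ring
      refine h4.trans ?_
      have hsq : ϱ ^ 2 / 4 ≤ ‖x₁ - x₃‖ ^ 2 := by nlinarith [norm_nonneg (x₁ - x₃)]
      have hϱ2 : 0 < ϱ ^ 2 := by positivity
      calc 4 * Mb = 16 * Mb / ϱ ^ 2 * (ϱ ^ 2 / 4) := by field_simp; ring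
        _ ≤ 16 * Mb / ϱ ^ 2 * ‖x₁ - x₃‖ ^ 2 := mul_le_mul_of_nonneg_left hsq (by positivity)
  · -- twice the first difference at the midpoint
    rw [norm_mul, Complex.norm_ofNat]
    have h := norm_sub_le_of_ballMargin hϱ hR hf hM hmn h₂
    rw [hmx, norm_smul, h2] at h
    calc 2 * ‖f m - f x₂‖ ≤ 2 * (4 * Mb / ϱ * (2⁻¹ * ‖x₁ - (2 : ℂ) • x₂ + x₃‖)) := by gcongr
      _ = 4 * Mb / ϱ * ‖x₁ - (2 : ℂ) • x₂ + x₃‖ := by ring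

end Banach

/-! ## §2 ★ The generator schemas (G-T1) and (G-T2-old) from the analytic reading (one generator `G : GenTower P 𝔸 M`, space table `sp`, admissibility `Adm`) -/
section Gen

variable {P : Params} {𝔸 : Type} {M : ℕ} (G : GenTower P 𝔸 M) (sp : (k : ℕ) → (domSys P M (k + 1)).Dom → Set (CPair P 𝔸))
  (Adm : (k : ℕ) → OlderTerms P 𝔸 M k → Prop)
  {Pot : ℕ → Type*} [∀ k, NormedAddCommGroup (Pot k)] [∀ k, NormedSpace ℂ (Pot k)]
  (ρ : (k : ℕ) → OlderTerms P 𝔸 M k → Pot k) (A : (k : ℕ) → ℝ → CPair P 𝔸 → (domSys P M (k + 1)).Dom → Pot k → ℂ)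

/-- A decay-weighted majorant of norms at a NON-EMPTY space table (on the inhabited domain types of record: the single-cube domain `cubeDom`) is non-negative. [folklore] -/
theorem majorant_nonneg_of_table (hsp : ∀ k X, (sp k X).Nonempty) {κ : ℝ} {k' : ℕ} {Dv : ℝ} (nr : (domSys P M (k' + 1)).Dom → CPair P 𝔸 → ℝ)
    (hnr : ∀ Y φ', 0 ≤ nr Y φ') (h : ∀ (Y : (domSys P M (k' + 1)).Dom), ∀ φ' ∈ sp k' Y, nr Y φ' ≤ Real.exp (-(κ * (domSys P M (k' + 1)).dj Y)) * Dv) :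
    0 ≤ Dv := by
  obtain ⟨φ', hφ'⟩ := hsp k' (cubeDom P M (k' + 1) 0)
  have h1 := h _ φ' hφ'
  have hpos : 0 < Real.exp (-(κ * (domSys P M (k' + 1)).dj (cubeDom P M (k' + 1) 0))) := Real.exp_pos _
  nlinarith [hnr (cubeDom P M (k' + 1) 0) φ']

/-- Reading an entry bound `nr ≤ e^{−κd}·Dv` as `e^{κd}·nr ≤ Dv`. [folklore] -/
theorem exp_mul_le_of_le_exp_neg_mul {κ dY nr Dv : ℝ} (h : nr ≤ Real.exp (-(κ * dY)) * Dv) : Real.exp (κ * dY) * nr ≤ Dv := by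
  have hpos : 0 < Real.exp (κ * dY) := Real.exp_pos _
  calc Real.exp (κ * dY) * nr ≤ Real.exp (κ * dY) * (Real.exp (-(κ * dY)) * Dv) := mul_le_mul_of_nonneg_left h hpos.le
    _ = Dv := by rw [← mul_assoc, ← Real.exp_add, add_neg_cancel, Real.exp_zero, one_mul]

open Finset in
/-- ★ **(G-T1) FROM THE ANALYTIC READING + THE LAST-COUPLING SCHEMA.**  (AR-fact)∕(AR-holo)∕(AR-adm)∕(AR-dom₁) with level weights `w ≥ 0`, `w k 0 = 0`, a space table non-empty at
every point, and (G-T1-last) `‖(G k).E t old φ X − (G k).E t′ old φ X‖ ≤ e^{−κd}·lam k·|t − t′|` at admissible `old` ⟹ module J53∕J54's (G-T1):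
**`‖(G k).E t old φ X − (G k).E t′ old′ φ X‖ ≤ e^{−κd_{k+1}(X)}(lam k·|t − t′| + Σ_{j≤k} (4M_b∕ϱ)·w k j·D j)`** for every majorant `D` of the decay-weighted differences of `old, old′` on
the tables — triangle through `(t′, old)`, then `norm_sub_le_of_ballMargin` at the read points with the reading bound `B = Σ_j w k j D j` (entries `≤ w k j D j`; the majorant is
non-negative at the levels `1, …, k` by `majorant_nonneg_of_table`, the `j = 0` weight vanishes). [folklore] -/
theorem genT1_of_analyticReading (hsp : ∀ k X, (sp k X).Nonempty) {γ κ R r₀ ϱ Mb : ℝ} {w : ℕ → ℕ → ℝ} {lam : ℕ → ℝ}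
    (hϱ : 0 < ϱ) (hR : r₀ + ϱ < R)
    (hGA : ∀ (k : ℕ), ∀ t ∈ Ioc (0 : ℝ) γ, ∀ (old : OlderTerms P 𝔸 M k), Adm k old → ∀ (X : (domSys P M (k + 1)).Dom), ∀ φ ∈ sp k X,
      (G k).E ((t : ℝ) : ℂ) old φ X = A k t φ X (ρ k old))
    (hA : ∀ (k : ℕ), ∀ t ∈ Ioc (0 : ℝ) γ, ∀ (X : (domSys P M (k + 1)).Dom), ∀ φ ∈ sp k X, DifferentiableOn ℂ (A k t φ X) (ball 0 R))
    (hMb : ∀ (k : ℕ), ∀ t ∈ Ioc (0 : ℝ) γ, ∀ (X : (domSys P M (k + 1)).Dom), ∀ φ ∈ sp k X, ∀ p ∈ ball (0 : Pot k) R,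
      ‖A k t φ X p‖ ≤ Mb * Real.exp (-(κ * (domSys P M (k + 1)).dj X)))
    (hAdmr : ∀ (k : ℕ) (old : OlderTerms P 𝔸 M k), Adm k old → ‖ρ k old‖ ≤ r₀)
    (hρ₁ : ∀ (k : ℕ) (o o' : OlderTerms P 𝔸 M k), Adm k o → Adm k o' → ∀ (B : ℝ), 0 ≤ B →
      (∀ (k' : ℕ) (hk' : k' < k) (Y : (domSys P M (k' + 1)).Dom), ∀ φ' ∈ sp k' Y,
        w k (k' + 1) * (Real.exp (κ * (domSys P M (k' + 1)).dj Y) * ‖o ⟨k' + 1, Nat.succ_lt_succ hk'⟩ Y φ' - o' ⟨k' + 1, Nat.succ_lt_succ hk'⟩ Y φ'‖) ≤ B) →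
      ‖ρ k o - ρ k o'‖ ≤ B)
    (hw : ∀ k j, 0 ≤ w k j) (hw0 : ∀ k, w k 0 = 0)
    (hGt : ∀ (k : ℕ), ∀ t ∈ Ioc (0 : ℝ) γ, ∀ t' ∈ Ioc (0 : ℝ) γ, ∀ (old : OlderTerms P 𝔸 M k), Adm k old → ∀ (X : (domSys P M (k + 1)).Dom), ∀ φ ∈ sp k X,
      ‖(G k).E ((t : ℝ) : ℂ) old φ X - (G k).E ((t' : ℝ) : ℂ) old φ X‖ ≤ Real.exp (-(κ * (domSys P M (k + 1)).dj X)) * (lam k * |t - t'|)) :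
    ∀ (k : ℕ), ∀ t ∈ Ioc (0 : ℝ) γ, ∀ t' ∈ Ioc (0 : ℝ) γ, ∀ (old old' : OlderTerms P 𝔸 M k), Adm k old → Adm k old' → ∀ (D : ℕ → ℝ),
      (∀ (k' : ℕ) (hk' : k' < k) (Y : (domSys P M (k' + 1)).Dom), ∀ φ' ∈ sp k' Y,
        ‖old ⟨k' + 1, Nat.succ_lt_succ hk'⟩ Y φ' - old' ⟨k' + 1, Nat.succ_lt_succ hk'⟩ Y φ'‖ ≤ Real.exp (-(κ * (domSys P M (k' + 1)).dj Y)) * D (k' + 1)) →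
      ∀ (X : (domSys P M (k + 1)).Dom), ∀ φ ∈ sp k X,
        ‖(G k).E ((t : ℝ) : ℂ) old φ X - (G k).E ((t' : ℝ) : ℂ) old' φ X‖ ≤
          Real.exp (-(κ * (domSys P M (k + 1)).dj X)) * (lam k * |t - t'| + ∑ j ∈ range (k + 1), (4 * Mb / ϱ * w k j) * D j) := by
  intro k t ht t' ht' old old' hold hold' D hD X φ hφ
  set e : ℝ := Real.exp (-(κ * (domSys P M (k + 1)).dj X)) with he
  have he0 : 0 < e := Real.exp_pos _
  have hr₀ : 0 ≤ r₀ := (norm_nonneg _).trans (hAdmr k old hold)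
  have hR0 : 0 < R := by linarith
  have hMb0 : 0 ≤ Mb := by
    have h := hMb k t ht X φ hφ 0 (mem_ball_self hR0)
    exact nonneg_of_mul_nonneg_left ((norm_nonneg _).trans h) he0
  -- the majorant is non-negative at the levels `1, …, k`
  have hD0 : ∀ k' (hk' : k' < k), 0 ≤ D (k' + 1) := fun k' hk' =>
    majorant_nonneg_of_table sp hsp (fun Y φ' => ‖old ⟨k' + 1, Nat.succ_lt_succ hk'⟩ Y φ' - old' ⟨k' + 1, Nat.succ_lt_succ hk'⟩ Y φ'‖)
      (fun _ _ => norm_nonneg _) (hD k' hk')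
  -- the reading bound `B := Σ_j w k j D j` (the `j = 0` term vanishes)
  set B : ℝ := ∑ j ∈ range (k + 1), w k j * D j with hB
  have hterm : ∀ j ∈ range (k + 1), 0 ≤ w k j * D j := by
    intro j hj
    rcases j with _ | j
    · rw [hw0, zero_mul]
    · exact mul_nonneg (hw k _) (hD0 j (by have := mem_range.mp hj; omega))
  have hB0 : 0 ≤ B := sum_nonneg hterm
  have hent : ∀ (k' : ℕ) (hk' : k' < k) (Y : (domSys P M (k' + 1)).Dom), ∀ φ' ∈ sp k' Y,
      w k (k' + 1) * (Real.exp (κ * (domSys P M (k' + 1)).dj Y) *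
        ‖old ⟨k' + 1, Nat.succ_lt_succ hk'⟩ Y φ' - old' ⟨k' + 1, Nat.succ_lt_succ hk'⟩ Y φ'‖) ≤ B := by
    intro k' hk' Y φ' hφ'
    calc _ ≤ w k (k' + 1) * D (k' + 1) := mul_le_mul_of_nonneg_left (exp_mul_le_of_le_exp_neg_mul (hD k' hk' Y φ' hφ')) (hw _ _)
      _ ≤ B := single_le_sum hterm (mem_range.mpr (by omega))
  have hρ := hρ₁ k old old' hold hold' B hB0 hent
  -- the split: last coupling first, then the older terms through the analytic reading
  have h1 := hGt k t ht t' ht' old hold X φ hφ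
  have h2 : ‖(G k).E ((t' : ℝ) : ℂ) old φ X - (G k).E ((t' : ℝ) : ℂ) old' φ X‖ ≤ e * (4 * Mb / ϱ * B) := by
    rw [hGA k t' ht' old hold X φ hφ, hGA k t' ht' old' hold' X φ hφ]
    have h := norm_sub_le_of_ballMargin hϱ hR (hA k t' ht' X φ hφ) (hMb k t' ht' X φ hφ) (hAdmr k old hold) (hAdmr k old' hold')
    calc _ ≤ 4 * (Mb * e) / ϱ * ‖ρ k old - ρ k old'‖ := h
      _ ≤ 4 * (Mb * e) / ϱ * B := mul_le_mul_of_nonneg_left hρ (by positivity)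
      _ = e * (4 * Mb / ϱ * B) := by ring
  have hsum : ∑ j ∈ range (k + 1), (4 * Mb / ϱ * w k j) * D j = 4 * Mb / ϱ * B := by
    rw [hB, mul_sum]
    exact sum_congr rfl fun j _ => by ring
  calc ‖(G k).E ((t : ℝ) : ℂ) old φ X - (G k).E ((t' : ℝ) : ℂ) old' φ X‖
      ≤ ‖(G k).E ((t : ℝ) : ℂ) old φ X - (G k).E ((t' : ℝ) : ℂ) old φ X‖ + ‖(G k).E ((t' : ℝ) : ℂ) old φ X - (G k).E ((t' : ℝ) : ℂ) old' φ X‖ :=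
        norm_sub_le_norm_sub_add_norm_sub _ _ _
    _ ≤ e * (lam k * |t - t'|) + e * (4 * Mb / ϱ * B) := add_le_add h1 h2
    _ = e * (lam k * |t - t'| + ∑ j ∈ range (k + 1), (4 * Mb / ϱ * w k j) * D j) := by rw [hsum]; ring

open Finset in
/-- ★ **dag-n22-a's SECOND-ORDER SCHEMA (G-T2-old) FROM THE ANALYTIC READING — no extra input.**  (AR-fact)∕(AR-holo)∕(AR-adm)∕(AR-dom₁)∕(AR-dom₂) with level weights `w ≥ 0`,
`w k 0 = 0` and a space table non-empty at every point ⟹ module J53∕J54's (G-T2-old): for `t ∈ ]0, γ]`, admissible `o₁, o₂, o₃` and majorants `D₁` (first differences `o₁ − o₂`,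
`o₂ − o₃`) ∕ `D₂` (second difference `o₁ − 2o₂ + o₃`) on the tables,
**`‖E(t,o₁) − 2E(t,o₂) + E(t,o₃)‖ ≤ e^{−κd_{k+1}(X)}·Σ_{j≤k}((4M_b∕ϱ)·w k j·D₂ j + (64M_b∕ϱ²)·(w k j)²·(D₁ j)²)`** — §1's three-point estimate at the read points `ρ o_i` (norms `≤ r₀`):
the linear channel reads `‖ρo₁ − 2ρo₂ + ρo₃‖ ≤ Σ_j w k j D₂ j` ((AR-dom₂)), the variance channel reads `‖ρo₁ − ρo₃‖ ≤ 2√(Σ_j (w k j D₁ j)²)` ((AR-dom₁) twice, entries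
`≤ w k j D₁ j ≤ √Σ`). [folklore] -/
theorem genT2old_of_analyticReading (hsp : ∀ k X, (sp k X).Nonempty) {γ κ R r₀ ϱ Mb : ℝ} {w : ℕ → ℕ → ℝ}
    (hϱ : 0 < ϱ) (hR : r₀ + ϱ < R)
    (hGA : ∀ (k : ℕ), ∀ t ∈ Ioc (0 : ℝ) γ, ∀ (old : OlderTerms P 𝔸 M k), Adm k old → ∀ (X : (domSys P M (k + 1)).Dom), ∀ φ ∈ sp k X,
      (G k).E ((t : ℝ) : ℂ) old φ X = A k t φ X (ρ k old))
    (hA : ∀ (k : ℕ), ∀ t ∈ Ioc (0 : ℝ) γ, ∀ (X : (domSys P M (k + 1)).Dom), ∀ φ ∈ sp k X, DifferentiableOn ℂ (A k t φ X) (ball 0 R))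
    (hMb : ∀ (k : ℕ), ∀ t ∈ Ioc (0 : ℝ) γ, ∀ (X : (domSys P M (k + 1)).Dom), ∀ φ ∈ sp k X, ∀ p ∈ ball (0 : Pot k) R,
      ‖A k t φ X p‖ ≤ Mb * Real.exp (-(κ * (domSys P M (k + 1)).dj X)))
    (hAdmr : ∀ (k : ℕ) (old : OlderTerms P 𝔸 M k), Adm k old → ‖ρ k old‖ ≤ r₀)
    (hρ₁ : ∀ (k : ℕ) (o o' : OlderTerms P 𝔸 M k), Adm k o → Adm k o' → ∀ (B : ℝ), 0 ≤ B →
      (∀ (k' : ℕ) (hk' : k' < k) (Y : (domSys P M (k' + 1)).Dom), ∀ φ' ∈ sp k' Y,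
        w k (k' + 1) * (Real.exp (κ * (domSys P M (k' + 1)).dj Y) * ‖o ⟨k' + 1, Nat.succ_lt_succ hk'⟩ Y φ' - o' ⟨k' + 1, Nat.succ_lt_succ hk'⟩ Y φ'‖) ≤ B) →
      ‖ρ k o - ρ k o'‖ ≤ B)
    (hρ₂ : ∀ (k : ℕ) (o₁ o₂ o₃ : OlderTerms P 𝔸 M k), Adm k o₁ → Adm k o₂ → Adm k o₃ → ∀ (B : ℝ), 0 ≤ B →
      (∀ (k' : ℕ) (hk' : k' < k) (Y : (domSys P M (k' + 1)).Dom), ∀ φ' ∈ sp k' Y,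
        w k (k' + 1) * (Real.exp (κ * (domSys P M (k' + 1)).dj Y) *
          ‖o₁ ⟨k' + 1, Nat.succ_lt_succ hk'⟩ Y φ' - 2 * o₂ ⟨k' + 1, Nat.succ_lt_succ hk'⟩ Y φ' + o₃ ⟨k' + 1, Nat.succ_lt_succ hk'⟩ Y φ'‖) ≤ B) →
      ‖ρ k o₁ - (2 : ℂ) • ρ k o₂ + ρ k o₃‖ ≤ B)
    (hw : ∀ k j, 0 ≤ w k j) (hw0 : ∀ k, w k 0 = 0) :
    ∀ (k : ℕ), ∀ t ∈ Ioc (0 : ℝ) γ, ∀ (o₁ o₂ o₃ : OlderTerms P 𝔸 M k), Adm k o₁ → Adm k o₂ → Adm k o₃ → ∀ (D₁ D₂ : ℕ → ℝ),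
      (∀ (k' : ℕ) (hk' : k' < k) (Y : (domSys P M (k' + 1)).Dom), ∀ φ' ∈ sp k' Y,
        ‖o₁ ⟨k' + 1, Nat.succ_lt_succ hk'⟩ Y φ' - o₂ ⟨k' + 1, Nat.succ_lt_succ hk'⟩ Y φ'‖ ≤ Real.exp (-(κ * (domSys P M (k' + 1)).dj Y)) * D₁ (k' + 1) ∧
        ‖o₂ ⟨k' + 1, Nat.succ_lt_succ hk'⟩ Y φ' - o₃ ⟨k' + 1, Nat.succ_lt_succ hk'⟩ Y φ'‖ ≤ Real.exp (-(κ * (domSys P M (k' + 1)).dj Y)) * D₁ (k' + 1) ∧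
        ‖o₁ ⟨k' + 1, Nat.succ_lt_succ hk'⟩ Y φ' - 2 * o₂ ⟨k' + 1, Nat.succ_lt_succ hk'⟩ Y φ' + o₃ ⟨k' + 1, Nat.succ_lt_succ hk'⟩ Y φ'‖ ≤
          Real.exp (-(κ * (domSys P M (k' + 1)).dj Y)) * D₂ (k' + 1)) →
      ∀ (X : (domSys P M (k + 1)).Dom), ∀ φ ∈ sp k X,
        ‖(G k).E ((t : ℝ) : ℂ) o₁ φ X - 2 * (G k).E ((t : ℝ) : ℂ) o₂ φ X + (G k).E ((t : ℝ) : ℂ) o₃ φ X‖ ≤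
          Real.exp (-(κ * (domSys P M (k + 1)).dj X)) * ∑ j ∈ range (k + 1), ((4 * Mb / ϱ * w k j) * D₂ j + (64 * Mb / ϱ ^ 2 * w k j ^ 2) * D₁ j ^ 2) := by
  intro k t ht o₁ o₂ o₃ ho₁ ho₂ ho₃ D₁ D₂ hD X φ hφ
  set e : ℝ := Real.exp (-(κ * (domSys P M (k + 1)).dj X)) with he
  have he0 : 0 < e := Real.exp_pos _
  have hr₀ : 0 ≤ r₀ := (norm_nonneg _).trans (hAdmr k o₁ ho₁)
  have hR0 : 0 < R := by linarith
  have hMb0 : 0 ≤ Mb := by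
    have h := hMb k t ht X φ hφ 0 (mem_ball_self hR0)
    exact nonneg_of_mul_nonneg_left ((norm_nonneg _).trans h) he0
  -- the majorants are non-negative at the levels `1, …, k`
  have hD₁0 : ∀ k' (hk' : k' < k), 0 ≤ D₁ (k' + 1) := fun k' hk' =>
    majorant_nonneg_of_table sp hsp (fun Y φ' => ‖o₁ ⟨k' + 1, Nat.succ_lt_succ hk'⟩ Y φ' - o₂ ⟨k' + 1, Nat.succ_lt_succ hk'⟩ Y φ'‖)
      (fun _ _ => norm_nonneg _) (fun Y φ' hφ' => (hD k' hk' Y φ' hφ').1)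
  have hD₂0 : ∀ k' (hk' : k' < k), 0 ≤ D₂ (k' + 1) := fun k' hk' =>
    majorant_nonneg_of_table sp hsp
      (fun Y φ' => ‖o₁ ⟨k' + 1, Nat.succ_lt_succ hk'⟩ Y φ' - 2 * o₂ ⟨k' + 1, Nat.succ_lt_succ hk'⟩ Y φ' + o₃ ⟨k' + 1, Nat.succ_lt_succ hk'⟩ Y φ'‖)
      (fun _ _ => norm_nonneg _) (fun Y φ' hφ' => (hD k' hk' Y φ' hφ').2.2)
  -- the second-difference reading bound `B₂ := Σ_j w k j D₂ j`
  set B₂ : ℝ := ∑ j ∈ range (k + 1), w k j * D₂ j with hB₂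
  have hterm₂ : ∀ j ∈ range (k + 1), 0 ≤ w k j * D₂ j := by
    intro j hj
    rcases j with _ | j
    · rw [hw0, zero_mul]
    · exact mul_nonneg (hw k _) (hD₂0 j (by have := mem_range.mp hj; omega))
  have hB₂0 : 0 ≤ B₂ := sum_nonneg hterm₂
  have hent₂ : ∀ (k' : ℕ) (hk' : k' < k) (Y : (domSys P M (k' + 1)).Dom), ∀ φ' ∈ sp k' Y,
      w k (k' + 1) * (Real.exp (κ * (domSys P M (k' + 1)).dj Y) *
        ‖o₁ ⟨k' + 1, Nat.succ_lt_succ hk'⟩ Y φ' - 2 * o₂ ⟨k' + 1, Nat.succ_lt_succ hk'⟩ Y φ' + o₃ ⟨k' + 1, Nat.succ_lt_succ hk'⟩ Y φ'‖) ≤ B₂ := by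
    intro k' hk' Y φ' hφ'
    calc _ ≤ w k (k' + 1) * D₂ (k' + 1) := mul_le_mul_of_nonneg_left (exp_mul_le_of_le_exp_neg_mul (hD k' hk' Y φ' hφ').2.2) (hw _ _)
      _ ≤ B₂ := single_le_sum hterm₂ (mem_range.mpr (by omega))
  have hx₂ := hρ₂ k o₁ o₂ o₃ ho₁ ho₂ ho₃ B₂ hB₂0 hent₂
  -- the first-difference reading bound `B₁ := √(Σ_j (w k j D₁ j)²)`
  set S₁ : ℝ := ∑ j ∈ range (k + 1), (w k j * D₁ j) ^ 2 with hS₁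
  have hS₁0 : 0 ≤ S₁ := sum_nonneg fun j _ => sq_nonneg _
  have hterm₁ : ∀ j ∈ range (k + 1), 0 ≤ w k j * D₁ j := by
    intro j hj
    rcases j with _ | j
    · rw [hw0, zero_mul]
    · exact mul_nonneg (hw k _) (hD₁0 j (by have := mem_range.mp hj; omega))
  have hent₁ : ∀ (oa ob : OlderTerms P 𝔸 M k),
      (∀ (k' : ℕ) (hk' : k' < k) (Y : (domSys P M (k' + 1)).Dom), ∀ φ' ∈ sp k' Y,
        ‖oa ⟨k' + 1, Nat.succ_lt_succ hk'⟩ Y φ' - ob ⟨k' + 1, Nat.succ_lt_succ hk'⟩ Y φ'‖ ≤ Real.exp (-(κ * (domSys P M (k' + 1)).dj Y)) * D₁ (k' + 1)) →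
      ∀ (k' : ℕ) (hk' : k' < k) (Y : (domSys P M (k' + 1)).Dom), ∀ φ' ∈ sp k' Y,
        w k (k' + 1) * (Real.exp (κ * (domSys P M (k' + 1)).dj Y) * ‖oa ⟨k' + 1, Nat.succ_lt_succ hk'⟩ Y φ' - ob ⟨k' + 1, Nat.succ_lt_succ hk'⟩ Y φ'‖) ≤
          Real.sqrt S₁ := by
    intro oa ob hab k' hk' Y φ' hφ'
    calc _ ≤ w k (k' + 1) * D₁ (k' + 1) := mul_le_mul_of_nonneg_left (exp_mul_le_of_le_exp_neg_mul (hab k' hk' Y φ' hφ')) (hw _ _)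
      _ ≤ Real.sqrt S₁ := by
          refine (le_abs_self _).trans (Real.abs_le_sqrt ?_)
          exact single_le_sum (f := fun j => (w k j * D₁ j) ^ 2) (fun j _ => sq_nonneg _) (mem_range.mpr (by omega))
  have h12 := hρ₁ k o₁ o₂ ho₁ ho₂ (Real.sqrt S₁) (Real.sqrt_nonneg _) (hent₁ o₁ o₂ fun k' hk' Y φ' hφ' => (hD k' hk' Y φ' hφ').1)
  have h23 := hρ₁ k o₂ o₃ ho₂ ho₃ (Real.sqrt S₁) (Real.sqrt_nonneg _) (hent₁ o₂ o₃ fun k' hk' Y φ' hφ' => (hD k' hk' Y φ' hφ').2.1)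
  have h13 : ‖ρ k o₁ - ρ k o₃‖ ^ 2 ≤ 4 * S₁ := by
    have h : ‖ρ k o₁ - ρ k o₃‖ ≤ 2 * Real.sqrt S₁ :=
      calc ‖ρ k o₁ - ρ k o₃‖ ≤ ‖ρ k o₁ - ρ k o₂‖ + ‖ρ k o₂ - ρ k o₃‖ := norm_sub_le_norm_sub_add_norm_sub _ _ _
        _ ≤ Real.sqrt S₁ + Real.sqrt S₁ := add_le_add h12 h23
        _ = 2 * Real.sqrt S₁ := by ring
    calc ‖ρ k o₁ - ρ k o₃‖ ^ 2 ≤ (2 * Real.sqrt S₁) ^ 2 := pow_le_pow_left₀ (norm_nonneg _) h 2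
      _ = 4 * S₁ := by rw [mul_pow, Real.sq_sqrt hS₁0]; ring
  -- the three-point estimate through the analytic reading
  rw [hGA k t ht o₁ ho₁ X φ hφ, hGA k t ht o₂ ho₂ X φ hφ, hGA k t ht o₃ ho₃ X φ hφ]
  have h3 := norm_threePoint_le_of_ballMargin hϱ hR (hA k t ht X φ hφ) (hMb k t ht X φ hφ) (hAdmr k o₁ ho₁) (hAdmr k o₂ ho₂) (hAdmr k o₃ ho₃)
  have hsumA : ∑ j ∈ range (k + 1), (4 * Mb / ϱ * w k j) * D₂ j = 4 * Mb / ϱ * B₂ := by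
    rw [hB₂, mul_sum]
    exact sum_congr rfl fun j _ => by ring
  have hsumB : ∑ j ∈ range (k + 1), (64 * Mb / ϱ ^ 2 * w k j ^ 2) * D₁ j ^ 2 = 16 * Mb / ϱ ^ 2 * (4 * S₁) := by
    rw [hS₁, mul_sum, mul_sum]
    exact sum_congr rfl fun j _ => by ring
  calc ‖A k t φ X (ρ k o₁) - 2 * A k t φ X (ρ k o₂) + A k t φ X (ρ k o₃)‖
      ≤ 4 * (Mb * e) / ϱ * ‖ρ k o₁ - (2 : ℂ) • ρ k o₂ + ρ k o₃‖ + 16 * (Mb * e) / ϱ ^ 2 * ‖ρ k o₁ - ρ k o₃‖ ^ 2 := h3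
    _ ≤ 4 * (Mb * e) / ϱ * B₂ + 16 * (Mb * e) / ϱ ^ 2 * (4 * S₁) := by gcongr
    _ = e * (4 * Mb / ϱ * B₂ + 16 * Mb / ϱ ^ 2 * (4 * S₁)) := by ring
    _ = e * ∑ j ∈ range (k + 1), ((4 * Mb / ϱ * w k j) * D₂ j + (64 * Mb / ϱ ^ 2 * w k j ^ 2) * D₁ j ^ 2) := by
        rw [sum_add_distrib, hsumA, hsumB]

end Gen

end YMDAG.N22.TermRecursion

end
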